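import Literature.Geometry.Lorentzian.GeodesicProofs
import HarnessLib

/-!
# One-sided uniqueness of geodesics: a geodesic ray is determined by its initial data

`Literature.Geometry.Lorentzian.GeodesicProofs` proves O'Neill's uniqueness lemma for geodesics
(`IsGeodesicOn.eqOn_of_velocity_eq_holds`, O'Neill 1983, Ch. 3, Lemma 22–23): two geodesics on an
*open* interval with the same position and velocity at one parameter coincide. Geodesic *rays*
`γ : [a, ∞) → M` — the generators of horizons (`Spacetime.IsRuledByCompleteNullGeodesics`,
`EventHorizonArea.lean`; Chruściel–Delay–Galloway–Howard 2001, §2: "the generators are allowed to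
have past endpoints") — are geodesics on the closed half-line `Ici a` only (`IsGeodesicOn … (Ici a)`:
the tangent lift is differentiable and the acceleration vanishes at every `t ≥ a`, nothing being
asked for `t < a`), and two rays issuing from the same endpoint with the same velocity have to be
compared from one-sided data. This file supplies that comparison:

* `IsGeodesicOn.tangentLift_eventuallyEq_nhdsGE` — local forward uniqueness: two geodesics on a
  right-neighbourhood `s ∈ 𝓝[≥] t₁` of `t₁` with the same tangent lift at `t₁` have the same tangent
  lift on a right-neighbourhood of `t₁` (the 1-jets in the chart at `γ t₁` solve the same Lipschitz
  first-order system, `hasDerivAt_oneJet_of_covariantDerivAlong_eq_zero` with the `C¹` Christoffel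
  data of `exists_christoffelChart`, and Mathlib's one-sided Grönwall uniqueness
  `ODE_solution_unique_of_mem_Icc_right` replaces `ODE_solution_unique_of_eventually`);
* `IsGeodesicOn.eqOn_Icc_of_velocity_eq` — two geodesics on `Icc t₀ b` with the same position and
  velocity at the *left endpoint* `t₀` coincide on `Icc t₀ b` (continuous induction,
  `IsClosed.Icc_subset_of_forall_mem_nhdsWithin`);
* `IsGeodesicOn.eqOn_Ici_of_velocity_eq` — the same on `Ici t₀`;
* `IsGeodesicOn.eqOn_Ici_comp_affine_of_velocity_eq_smul` — if a geodesic ray `γ'` on `Ici t₀'`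
  starts at the point `γ t₀` of a geodesic ray `γ` (on `Ici a`, `a ≤ t₀`) with velocity
  `c • γ'(t₀)`, `c ≥ 0`, then `γ' s = γ (t₀ + c (s - t₀'))` for all `s ≥ t₀'` (affine
  reparametrisation, `IsGeodesicOn.comp_affine_holds`, then forward uniqueness).

All of this is the standard uniqueness theorem for the geodesic initial value problem (O'Neill
1983, Ch. 3, Lemma 22, p. 68: "the existence and uniqueness theorem for ordinary differential
equations gives the following result … if `α'(a) = β'(a)` then `α = β`"; the one-sided version is
the forward uniqueness of the Cauchy problem for a locally Lipschitz system), for a `C¹` connection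
on a Hausdorff manifold, at interior points. No definitions and no named facts are introduced.

## References

* B. O'Neill, *Semi-Riemannian geometry with applications to relativity*, Academic Press 1983,
  Ch. 3, Lemma 22–Prop. 24 and Lemma 26 (p. 68–69). Key `ONeillSemiRiemannian1983`.
* P. T. Chruściel, E. Delay, G. J. Galloway, R. Howard, *Regularity of horizons and the area
  theorem*, Ann. Henri Poincaré 2 (2001) 109–178, §2. Key `ChruscielEtAl2001`.
-/

noncomputable section

open Bundle Set Filter Function
open scoped Manifold ContDiff Topology

namespace Literature.Geometry.Lorentzian

variable {E : Type*} [NormedAddCommGroup E] [NormedSpace ℝ E] {H : Type*} [TopologicalSpace H]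
  {I : ModelWithCorners ℝ E H} {M : Type*} [TopologicalSpace M] [ChartedSpace H M]
  [IsManifold I ∞ M] [FiniteDimensional ℝ E]
  {cov : CovariantDerivative I E (TangentSpace I : M → Type _)}

/-! ### Local forward uniqueness -/

/-- **Local forward uniqueness of geodesics.** For a `C¹` connection on a Hausdorff manifold, two
geodesics on a right-neighbourhood `s ∈ 𝓝[≥] t₁` of the parameter `t₁`, with the same tangent lift
in `TM` at `t₁` (same position and velocity) at an interior point `γ t₁` of `M`, have the same
tangent lift on a right-neighbourhood of `t₁`. The 1-jets of both curves in the chart at `γ t₁`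
solve the first-order system `(u, w)' = (w, -∑ᵢ wⁱ Ĉᵢ(φ⁻¹ u) w)` at every parameter of `s` near
`t₁` (`hasDerivAt_oneJet_of_covariantDerivAlong_eq_zero`, `exists_christoffelChart`), whose
right-hand side is Lipschitz near the common initial value, so the one-sided uniqueness theorem
for ODEs (`ODE_solution_unique_of_mem_Icc_right`) applies. O'Neill 1983, Ch. 3, Lemma 22 (p. 68),
one-sided form. [cite: ONeillSemiRiemannian1983, Ch. 3, Lemma 22 (p. 68)] -/
theorem IsGeodesicOn.tangentLift_eventuallyEq_nhdsGE [T2Space M]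
    [CovariantDerivative.ContMDiffCovariantDerivative cov 1]
    {γ γ' : ℝ → M} {s : Set ℝ} (hγ : IsGeodesicOn cov γ s) (hγ' : IsGeodesicOn cov γ' s)
    {t₁ : ℝ} (hs : s ∈ 𝓝[≥] t₁) (hx : I.IsInteriorPoint (γ t₁))
    (h : tangentLift I γ t₁ = tangentLift I γ' t₁) :
    tangentLift I γ =ᶠ[𝓝[≥] t₁] tangentLift I γ' := by
  have ht₁s : t₁ ∈ s := mem_of_mem_nhdsWithin (mem_Ici.mpr le_rfl) hs
  have h0 : γ t₁ = γ' t₁ := congrArg TotalSpace.proj h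
  set b := Module.finBasis ℝ E with hb_def
  obtain ⟨N, Ĉ, hN, hx₁N, hNs, hĈ, hĈs⟩ := exists_christoffelChart (cov := cov) b (γ t₁)
  set φ := extChartAt I (γ t₁) with hφ_def
  set e₁ := trivializationAt E (TangentSpace I : M → Type _) (γ t₁) with he₁_def
  -- the right-hand side of the first-order system and the 1-jets of curves in the chart
  set G : E × E → E := fun pq ↦ -∑ i, b.repr pq.2 i • Ĉ i (φ.symm pq.1) pq.2 with hG_def
  set F : E × E → E × E := fun pq ↦ (pq.2, G pq) with hF_def
  set f : (ℝ → M) → ℝ → E × E := fun β t ↦ (φ (β t), (e₁ (tangentLift I β t)).2) with hf_def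
  -- (i) `F` is `C¹` near `f γ t₁`, hence Lipschitz on a neighbourhood
  have hF : ∀ q : E, ContDiffAt ℝ 1 F (φ (γ t₁), q) := by
    intro q
    have hG : ContDiffAt ℝ 1 G (φ (γ t₁), q) := by
      have h1 : ∀ i, ContDiffAt ℝ 1 (fun pq : E × E ↦ Ĉ i (φ.symm pq.1)) (φ (γ t₁), q) := by
        intro i
        have h2 : ContMDiffWithinAt 𝓘(ℝ, E) 𝓘(ℝ, E →L[ℝ] E) 1 (Ĉ i ∘ φ.symm) (range I)
            (φ (γ t₁)) := by
          refine ContMDiffAt.comp_contMDiffWithinAt _ ?_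
            (contMDiffWithinAt_extChartAt_symm_range (γ t₁) (mem_extChartAt_target (γ t₁)))
          rw [hφ_def, extChartAt_to_inv]
          exact hĈs i
        have h3 : ContDiffAt ℝ 1 (Ĉ i ∘ φ.symm) (φ (γ t₁)) :=
          (contMDiffWithinAt_iff_contDiffWithinAt.mp h2).contDiffAt
            (range_mem_nhds_isInteriorPoint hx)
        exact ContDiffAt.comp (f := Prod.fst) (φ (γ t₁), q) h3 contDiffAt_fst
      have h4 : ∀ i, ContDiffAt ℝ 1 (fun pq : E × E ↦ b.repr pq.2 i) (φ (γ t₁), q) := fun i ↦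
        (((b.coord i).toContinuousLinearMap).contDiff.comp contDiff_snd).contDiffAt
      exact (ContDiffAt.sum fun i _ ↦ (h4 i).smul ((h1 i).clm_apply contDiffAt_snd)).neg
    exact contDiffAt_snd.prodMk hG
  obtain ⟨K, S, hS, hlip⟩ := (hF (f γ t₁).2).exists_lipschitzOnWith
  -- (ii) both 1-jets solve the system at the parameters of `s` near `t₁` and stay in `S`
  have hsol : ∀ β : ℝ → M, IsGeodesicOn cov β s → β t₁ = γ t₁ → f β t₁ = f γ t₁ →
      ∀ᶠ t in 𝓝[≥] t₁, HasDerivAt (f β) (F (f β t)) t ∧ f β t ∈ S := by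
    intro β hβ hβ₁ hβ₂
    have hβc : ContinuousAt β t₁ :=
      (mdifferentiableAt_of_mdifferentiableAt_lift (hβ.1 t₁ ht₁s)).continuousAt
    have hN' : ∀ᶠ t in 𝓝 t₁, β t ∈ N := hβc.preimage_mem_nhds (hN.mem_nhds (hβ₁ ▸ hx₁N))
    have hder : ∀ᶠ t in 𝓝[≥] t₁, HasDerivAt (f β) (F (f β t)) t := by
      filter_upwards [nhdsWithin_le_nhds hN', hs] with t htN hts
      have hd := hasDerivAt_oneJet_of_covariantDerivAlong_eq_zero (cov := cov) b hNs Ĉ hĈ htN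
        (hβ.1 t hts) (hβ.2 t hts)
      refine hd.congr_deriv ?_
      have hβt : φ.symm (φ (β t)) = β t :=
        φ.left_inv (by simpa only [hφ_def, extChartAt_source] using hNs htN)
      simp only [hF_def, hG_def, hf_def, hβt]
      rfl
    have hcont : ContinuousAt (f β) t₁ :=
      (hder.self_of_nhdsWithin (mem_Ici.mpr le_rfl)).continuousAt
    have hS' : ∀ᶠ t in 𝓝[≥] t₁, f β t ∈ S :=
      nhdsWithin_le_nhds (hcont.preimage_mem_nhds (by rwa [hβ₂]))
    exact hder.and hS'
  -- (iii) one-sided uniqueness of solutions of the system on a small interval `[t₁, t₁ + δ]`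
  have hf₁ : f γ' t₁ = f γ t₁ := by simp only [hf_def, h, h0]
  obtain ⟨u, hu, hsub⟩ := mem_nhdsGE_iff_exists_Ico_subset.mp
    ((hsol γ hγ rfl rfl).and (hsol γ' hγ' h0.symm hf₁))
  have hu' : t₁ < u := hu
  set δ : ℝ := (u - t₁) / 2 with hδ
  have hδ0 : 0 < δ := by rw [hδ]; linarith
  have hIcc : Icc t₁ (t₁ + δ) ⊆ Ico t₁ u := fun t ht ↦ ⟨ht.1, by linarith [ht.2]⟩
  have hP : ∀ t ∈ Icc t₁ (t₁ + δ), (HasDerivAt (f γ) (F (f γ t)) t ∧ f γ t ∈ S) ∧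
      (HasDerivAt (f γ') (F (f γ' t)) t ∧ f γ' t ∈ S) := fun t ht ↦ hsub (hIcc ht)
  have heq : EqOn (f γ) (f γ') (Icc t₁ (t₁ + δ)) :=
    ODE_solution_unique_of_mem_Icc_right (v := fun _ ↦ F) (s := fun _ ↦ S) (K := K)
      (fun _ _ ↦ hlip)
      (HasDerivAt.continuousOn fun t ht ↦ (hP t ht).1.1)
      (fun t ht ↦ (hP t (Ico_subset_Icc_self ht)).1.1.hasDerivWithinAt)
      (fun t ht ↦ (hP t (Ico_subset_Icc_self ht)).1.2)
      (HasDerivAt.continuousOn fun t ht ↦ (hP t ht).2.1)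
      (fun t ht ↦ (hP t (Ico_subset_Icc_self ht)).2.1.hasDerivWithinAt)
      (fun t ht ↦ (hP t (Ico_subset_Icc_self ht)).2.2) hf₁.symm
  have heq' : f γ =ᶠ[𝓝[≥] t₁] f γ' :=
    eventuallyEq_of_mem (Icc_mem_nhdsGE (by linarith : t₁ < t₁ + δ)) heq
  -- (iv) back to the tangent lifts
  have hc : ContinuousAt γ t₁ :=
    (mdifferentiableAt_of_mdifferentiableAt_lift (hγ.1 t₁ ht₁s)).continuousAt
  have hc' : ContinuousAt γ' t₁ :=
    (mdifferentiableAt_of_mdifferentiableAt_lift (hγ'.1 t₁ ht₁s)).continuousAt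
  have hsrc : ∀ᶠ t in 𝓝 t₁, γ t ∈ (chartAt H (γ t₁)).source :=
    hc.preimage_mem_nhds ((chartAt H (γ t₁)).open_source.mem_nhds (mem_chart_source H (γ t₁)))
  have hsrc' : ∀ᶠ t in 𝓝 t₁, γ' t ∈ (chartAt H (γ t₁)).source :=
    hc'.preimage_mem_nhds
      ((chartAt H (γ t₁)).open_source.mem_nhds (h0 ▸ mem_chart_source H (γ' t₁)))
  filter_upwards [heq', nhdsWithin_le_nhds hsrc, nhdsWithin_le_nhds hsrc'] with t ht hγt hγ't
  have h1 : γ t = γ' t :=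
    φ.injOn (by simpa only [hφ_def, extChartAt_source] using hγt)
      (by simpa only [hφ_def, extChartAt_source] using hγ't) (Prod.ext_iff.1 ht).1
  have hm : tangentLift I γ t ∈ e₁.source := e₁.mem_source.2 (by simpa [he₁_def] using hγt)
  have hm' : tangentLift I γ' t ∈ e₁.source := e₁.mem_source.2 (by simpa [he₁_def] using hγ't)
  have h2 : e₁ (tangentLift I γ t) = e₁ (tangentLift I γ' t) :=
    Prod.ext (by rw [e₁.coe_fst hm, e₁.coe_fst hm']; exact h1) (Prod.ext_iff.1 ht).2
  exact e₁.injOn hm hm' h2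

/-! ### Forward uniqueness on intervals with included left endpoint -/

/-- **Forward uniqueness of geodesics on a closed interval.** For a `C¹` connection on a Hausdorff
manifold without boundary, two geodesics on `Icc t₀ b` with the same position and velocity at the
left endpoint `t₀` coincide on `Icc t₀ b`: the set of parameters at which the tangent lifts agree
contains `t₀`, is closed in `Icc t₀ b` (the lifts are continuous into the Hausdorff space `TM`) and
is a right-neighbourhood of each of its points (`tangentLift_eventuallyEq_nhdsGE`), hence is all of
`Icc t₀ b` (`IsClosed.Icc_subset_of_forall_mem_nhdsWithin`). O'Neill 1983, Ch. 3, Lemma 22 and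
Prop. 24 (p. 68), one-sided form. [cite: ONeillSemiRiemannian1983, Ch. 3, Lemma 22 (p. 68)] -/
theorem IsGeodesicOn.eqOn_Icc_of_velocity_eq [T2Space M] [BoundarylessManifold I M]
    [CovariantDerivative.ContMDiffCovariantDerivative cov 1]
    {γ γ' : ℝ → M} {t₀ b : ℝ} (hγ : IsGeodesicOn cov γ (Icc t₀ b))
    (hγ' : IsGeodesicOn cov γ' (Icc t₀ b)) (h0 : γ t₀ = γ' t₀)
    (hv : velocity I γ t₀ = velocity I γ' t₀) : EqOn γ γ' (Icc t₀ b) := by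
  haveI : T2Space (TangentBundle I M) := t2Space_totalSpace
  rcases lt_or_ge b t₀ with hb | hb
  · intro t ht; exact absurd (ht.1.trans ht.2) (not_le.mpr hb)
  set u : Set ℝ := {t | tangentLift I γ t = tangentLift I γ' t} with hu_def
  have hl0 : tangentLift I γ t₀ = tangentLift I γ' t₀ := TotalSpace.ext h0 (heq_of_eq hv)
  suffices hsu : Icc t₀ b ⊆ u from fun t ht ↦ congrArg TotalSpace.proj (hsu ht)
  refine IsClosed.Icc_subset_of_forall_mem_nhdsWithin ?_ hl0 ?_
  · -- `u ∩ Icc t₀ b` is closed: continuity of the lifts on `Icc t₀ b` into the Hausdorff `TM`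
    have hc : ContinuousOn (fun t ↦ (tangentLift I γ t, tangentLift I γ' t)) (Icc t₀ b) :=
      fun t ht ↦ ((hγ.1 t ht).continuousAt.prodMk (hγ'.1 t ht).continuousAt).continuousWithinAt
    have := hc.preimage_isClosed_of_isClosed isClosed_Icc isClosed_diagonal
    rw [inter_comm]
    convert this using 1
    ext t
    simp only [mem_inter_iff, mem_preimage, mem_diagonal_iff, hu_def, mem_setOf_eq]
  · rintro t ⟨htu, ht⟩
    have hs : Icc t₀ b ∈ 𝓝[≥] t := mem_of_superset (Icc_mem_nhdsGE ht.2) (Icc_subset_Icc_left ht.1)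
    have hloc := (hγ.tangentLift_eventuallyEq_nhdsGE hγ' hs BoundarylessManifold.isInteriorPoint
      htu)
    exact nhdsWithin_mono t Ioi_subset_Ici_self hloc

/-- **Forward uniqueness of geodesic rays.** For a `C¹` connection on a Hausdorff manifold without
boundary, two geodesics on the closed half-line `Ici t₀` with the same position and velocity at
`t₀` coincide on `Ici t₀`. O'Neill 1983, Ch. 3, Lemma 22 and Prop. 24 (p. 68), one-sided form.
[cite: ONeillSemiRiemannian1983, Ch. 3, Lemma 22 (p. 68)] -/
theorem IsGeodesicOn.eqOn_Ici_of_velocity_eq [T2Space M] [BoundarylessManifold I M]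
    [CovariantDerivative.ContMDiffCovariantDerivative cov 1]
    {γ γ' : ℝ → M} {t₀ : ℝ} (hγ : IsGeodesicOn cov γ (Ici t₀))
    (hγ' : IsGeodesicOn cov γ' (Ici t₀)) (h0 : γ t₀ = γ' t₀)
    (hv : velocity I γ t₀ = velocity I γ' t₀) : EqOn γ γ' (Ici t₀) := by
  intro t ht
  exact (hγ.mono Icc_subset_Ici_self).eqOn_Icc_of_velocity_eq (b := t)
    (hγ'.mono Icc_subset_Ici_self) h0 hv ⟨ht, le_rfl⟩

/-- **A geodesic ray issuing tangentially from a point of a geodesic ray lies on it.** For a `C¹`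
connection on a Hausdorff manifold without boundary, let `γ` be a geodesic on `Ici a` and `γ'` a
geodesic on `Ici t₀'` with `γ' t₀' = γ t₀` for some `t₀ ≥ a` and `γ''(t₀') = c • γ'(t₀)` with
`c ≥ 0` (a cross-fibre equation in the model space `E = T_{γ' t₀'} M = T_{γ t₀} M`). Then
`γ' s = γ (t₀ + c (s - t₀'))` for every `s ≥ t₀'`: the right-hand side is a geodesic on `Ici t₀'`
(affine reparametrisation, `IsGeodesicOn.comp_affine_holds`; `t₀ + c (s - t₀') ≥ a`) with the same
initial data, and forward uniqueness applies. O'Neill 1983, Ch. 3, Lemma 22 and Lemma 26 (affine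
reparametrisations of geodesics). [cite: ONeillSemiRiemannian1983, Ch. 3, Lemma 22 and Lemma 26] -/
theorem IsGeodesicOn.eqOn_Ici_comp_affine_of_velocity_eq_smul [T2Space M] [BoundarylessManifold I M]
    [CovariantDerivative.ContMDiffCovariantDerivative cov 1]
    {γ γ' : ℝ → M} {a t₀ t₀' c : ℝ} (hγ : IsGeodesicOn cov γ (Ici a))
    (hγ' : IsGeodesicOn cov γ' (Ici t₀')) (ht₀ : a ≤ t₀) (hc : 0 ≤ c) (h0 : γ' t₀' = γ t₀)
    (hv : (velocity I γ' t₀' : E) = c • (velocity I γ t₀ : E)) :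
    EqOn γ' (fun s ↦ γ (t₀ + c * (s - t₀'))) (Ici t₀') := by
  -- the reparametrised ray, in the form of `comp_affine`
  set ζ : ℝ → M := fun s ↦ γ (c * s + (t₀ - c * t₀')) with hζ
  have hζeq : (fun s ↦ γ (t₀ + c * (s - t₀'))) = ζ := by
    funext s; simp only [hζ]; congr 1; ring
  rw [hζeq]
  have hpre : Ici t₀' ⊆ (fun s ↦ c * s + (t₀ - c * t₀')) ⁻¹' Ici a := by
    intro s hs
    have : 0 ≤ c * (s - t₀') := mul_nonneg hc (by linarith [mem_Ici.mp hs])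
    show a ≤ c * s + (t₀ - c * t₀')
    nlinarith
  have hζg : IsGeodesicOn cov ζ (Ici t₀') := (IsGeodesicOn.comp_affine_holds hγ c _).mono hpre
  -- initial data of `ζ` at `t₀'`
  have harg : c * t₀' + (t₀ - c * t₀') = t₀ := by ring
  have hζ0 : ζ t₀' = γ t₀ := by simp only [hζ, harg]
  have hζv' : (velocity I ζ t₀' : E) = c • (velocity I γ t₀ : E) := by
    have h1 : (velocity I ζ t₀' : E) = c • (velocity I γ (c * t₀' + (t₀ - c * t₀')) : E) :=
      velocity_comp_affine γ c (t₀ - c * t₀') t₀'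
    have h2 : c • (velocity I γ (c * t₀' + (t₀ - c * t₀')) : E) = c • (velocity I γ t₀ : E) := by
      rw [harg]
    exact h1.trans h2
  refine hγ'.eqOn_Ici_of_velocity_eq hζg (h0.trans hζ0.symm) ?_
  exact hv.trans hζv'.symm

end Literature.Geometry.Lorentzian

end
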